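import Mathlib
import Summits.Schanuel.Schanuel.Theorems.RigidCoreMinimalCounterexampleInAclCorankGeTwoLogPartAperiodic
import Summits.Schanuel.Schanuel.Theorems.RigidCoreMinimalCounterexampleInAclCorankGeTwoHitSetRingDefinable

/-!
# THE LOG COORDINATES OF A CORANK ≥ 2 FIRST FAILURE ARE IN `acl(∅)` MODULO ONE-LINE RIGIDITY — unconditional assembly
# (crux stmt-Schanuel-0969 `RigidCore.MinimalCounterexampleInAcl`, line kernel-arithmetic-selection, lead c13)

`--supports stmt-Schanuel-0969`.  With S7a LANDED (`stub_corankGeTwo_hitSetRingDefinable`, Theorems/…CorankGeTwoHitSetRingDefinable, p144042: the hit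
pattern of the log part of a corank ≥ 2 first failure is ring-definable over `ℤ`), the glue of Theorems/…CorankGeTwoLogPart (p141402) and
…CorankGeTwoLogPartAperiodic (p144101) gives two UNCONDITIONAL theorems on the corank ≥ 2 sector of item stmt-14744 — normal-form first
failures `x` of rank `n ≥ 3` with `r ≤ n − 2` log coordinates (indices `i < r`, `e^{x_i} ∈ ℚ̄`), pure in the remaining directions:

* `corankGeTwo_logCoords_mem_expAcl_of_noFullLine` (registered `stub_corankGeTwo_logCoords`) — if no non-zero integer direction supported on
  the log indices carries a full line of mates through `x`, then every log coordinate `x_i` (`i < r`) lies in `acl^{ℂ_exp}(∅)`;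
* `corankGeTwo_logCoords_mem_expAcl_of_aperiodic` (registered `stub_corankGeTwo_logCoordsAperiodic`) — the same under the exact, weaker
  hypothesis that the hit pattern of the log part has no non-zero period supported on the log indices.

So the only input standing between the log part of the corank ≥ 2 sector and `acl(∅)` is the one-line rigidity / aperiodicity statement
(stub S7b `stub_corankGeTwo_noFullLine`; obstruction note `Cruxes/MinimalCounterexampleInAcl/Lines/kernel_arithmetic_selection_S7b_obstruction.md`).

References: status note `Cruxes/MinimalCounterexampleInAcl/Lines/kernel_arithmetic_selection.md` §Addendum c13; [KirbyMacintyreOnshuus2012] §2;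
[Kirby2010] Prop. 7.2.
-/

noncomputable section

set_option linter.dupNamespace false

open Complex Set FirstOrder

namespace Summit.Schanuel.Schanuel.Cruxes.MinimalCounterexampleInAcl.KernelArithmeticSelection

open Literature.ModelTheory.ExponentialFields
open Summit.Schanuel.Schanuel.Theorems.AclSubsetLogFreeCore.Negative

/-- **LOG COORDINATES OF A CORANK ≥ 2 FIRST FAILURE ARE IN `acl(∅)` MODULO "NO FULL LINE"** (unconditional: S7a + transfer + selector).
Registered stub `stub_corankGeTwo_logCoords`. [cite: Kirby2010, Prop. 7.2] -/
theorem stub_corankGeTwo_logCoords : ∀ (n r : ℕ), 3 ≤ n → r + 2 ≤ n → ∀ (x : Fin n → ℂ), x ∈ Summit.Schanuel.Schanuel.Cruxes.MinimalCounterexampleInAcl.KernelArithmeticSelection.firstFailures n → (∀ i : Fin n, (i : ℕ) < r → IsAlgebraic ℚ (Complex.exp (x i))) → (∀ M : Fin n → ℤ, (∃ i : Fin n, r ≤ (i : ℕ) ∧ M i ≠ 0) → Transcendental ℚ (Complex.exp (∑ i, (M i : ℂ) * x i))) → (∀ μ : Fin n → ℤ, (∀ i : Fin n, r ≤ (i :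 ℕ) → μ i = 0) → μ ≠ 0 → ∃ j : ℤ, ¬ ∃ x' ∈ Summit.Schanuel.Schanuel.Cruxes.MinimalCounterexampleInAcl.KernelArithmeticSelection.locusMates x, ∀ i : Fin n, (i : ℕ) < r → x' i = x i + 2 * ↑Real.pi * Complex.I * ((j • μ) i : ℂ)) → ∀ i : Fin n, (i : ℕ) < r → x i ∈ Summit.Schanuel.Schanuel.Theorems.AclSubsetLogFreeCore.Negative.expAcl :=
  fun n r hn hr x hx halg hpure hno =>
    logCoords_mem_expAcl_of_ringDefinable_of_noFullLine (by omega) hx.1 halg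
      (@stub_corankGeTwo_hitSetRingDefinable n r hn hr x hx halg hpure (FirstOrder.Ring.compatibleRingOfRing ℤ)) hno

/-- **LOG COORDINATES OF A CORANK ≥ 2 FIRST FAILURE ARE IN `acl(∅)` MODULO APERIODICITY OF ITS HIT PATTERN** (unconditional: S7a +
transfer `stub_arithmeticTransfer` + the selector under its exact hypothesis `logCoords_mem_expAcl_of_pattern_of_aperiodic`).  Registered stub
`stub_corankGeTwo_logCoordsAperiodic`. [cite: KirbyMacintyreOnshuus2012, §2] -/
theorem stub_corankGeTwo_logCoordsAperiodic : ∀ (n r : ℕ), 3 ≤ n → r + 2 ≤ n → ∀ (x : Fin n → ℂ), x ∈ Summit.Schanuel.Schanuel.Cruxes.MinimalCounterexampleInAcl.KernelArithmeticSelection.firstFailures n → (∀ i : Fin n, (i : ℕ) < r → IsAlgebraic ℚ (Complex.exp (x i))) → (∀ M : Fin n → ℤ, (∃ i : Fin n, r ≤ (i : ℕ) ∧ M i ≠ 0) → Transcendental ℚ (Complex.exp (∑ i, (M i : ℂ) * x i))) → (∀ μ : Fin n → ℤ, (∀ i : Fin n, r ≤ (i : ℕ) → μ i = 0) → (∀ κ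 : Fin n → ℤ, (∀ i : Fin n, r ≤ (i : ℕ) → κ i = 0) → ((∃ x' ∈ Summit.Schanuel.Schanuel.Cruxes.MinimalCounterexampleInAcl.KernelArithmeticSelection.locusMates x, ∀ i : Fin n, (i : ℕ) < r → x' i = x i + 2 * ↑Real.pi * Complex.I * (κ i : ℂ)) ↔ ∃ x' ∈ Summit.Schanuel.Schanuel.Cruxes.MinimalCounterexampleInAcl.KernelArithmeticSelection.locusMates x, ∀ i : Fin n, (i : ℕ) < r → x' i = x i + 2 * ↑Real.pi * Complex.I * ((μ + κ) i : ℂ))) → μ = 0) → ∀ i : Fin n, (i : ℕ) < r → x i ∈ Summit.Schanuel.Schanuel.Theorems.AclSubsetLogFreeCore.Negative.expAcl := by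
  intro n r hn hr x hx halg hpure haper
  have hA := @stub_corankGeTwo_hitSetRingDefinable n r hn hr x hx halg hpure (FirstOrder.Ring.compatibleRingOfRing ℤ)
  have hT := stub_arithmeticTransfer n _ hA
  refine logCoords_mem_expAcl_of_pattern_of_aperiodic (by omega) hx.1 halg ?_ haper
  convert hT using 1
  ext w
  simp only [mem_setOf_eq]
  constructor
  · rintro ⟨κ, hw, hκ0, hx'⟩
    exact ⟨κ, ⟨hκ0, hx'⟩, hw⟩
  · rintro ⟨κ, ⟨hκ0, hx'⟩, hw⟩
    exact ⟨κ, hw, hκ0, hx'⟩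

end Summit.Schanuel.Schanuel.Cruxes.MinimalCounterexampleInAcl.KernelArithmeticSelection

end
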